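import Mathlib
import HarnessLib
import HarnessLib.Audit
import Summits.CriticalPhenomena.Statement

/-!
Route: PercShatteringRace

DORMANT since 2026-08-24T02:23:44Z (reconciler: no traction for 6.4 d (last activity item-evidence-added at 2026-08-17T14:57:26Z); parked, not closed — `ledger route dormant route-CriticalPhenomena-PercShatteringRace --off` to reactivat) — unstaffed, not closed; items shared with open routes are served there. `ledger route dormant <id> --off` reactivates.

# Route PercShatteringRace — free-box susceptibility power saving S(1/2) races Cerf-type annulus
uniqueness U(1/6) — (7/6)(5/2) < 3 kills a jump at p_c

It suffices to show X = S(1/2) ∧ U(1/6) (card shattering-vs-uniqueness-race), two UNCONDITIONAL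
statements about critical bond
percolation on ℤ³ (measure bondPercolation (zdGraph 3) (criticalProbI 3)) seen inside a finite box
Λ_R = box 3 R = [−R,R]³ with FREE
boundary conditions (connections inside Λ_R only, openConnIn):
 S(1/2) = FreeSusceptibilityPowerSaving — the free (in-box) susceptibility of the centre has a power
saving: Σ_{y∈Λ_R} P_{p_c}(0 ↔ y
inside Λ_R) ≤ C R^{5/2} for all R ≥ 1 (truth ≈ R^{2−η} = R^{2.05}; Hutchcroft's 'folklore' o(R³)
with a rate; a = 1/2 in the card's S(a):
Σ ≤ C R^{3−a});
 U(1/6) = NearLinearTwoClusterDecay — Cerf-type annulus uniqueness at polynomial aspect 7/6: the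
probability that ω restricted to Λ_R,
R = ⌈r^{7/6}⌉, contains two DISTINCT open clusters each meeting both Λ_r and the inner vertex
boundary ∂ⁱⁿΛ_R tends to 0 as r → ∞
(Cerf2015 Thm 1.2 proves aspect r^{43}; U(1/6) is literally route PercFiniteBoxLRO's crux
CritBoxTwoArmsDecay at α = 7/6; b = 1/6 in
the card's U(b)).
The exchange rate is (1+b)(3−a) < 3, here (7/6)(5/2) = 35/12 < 3.
Lean: `(∃ C : ℝ, ∀ R : ℕ, 1 ≤ R → ∑ y ∈ Literature.Probability.LatticeModels.box 3 R,
(Literature.Probability.Percolation.bondPercolation (Literature.Probability.LatticeModels.zdGraph 3)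
(Literature.Probability.Percolation.criticalProbI 3)).real
(Literature.Probability.Percolation.openConnIn ↑(Literature.Probability.LatticeModels.box 3 R) 0 y)
≤ C * (R : ℝ) ^ ((5 : ℝ) / 2)) ∧ (Filter.Tendsto (fun n : ℕ =>
(Literature.Probability.Percolation.bondPercolation (Literature.Probability.LatticeModels.zdGraph 3)
(Literature.Probability.Percolation.criticalProbI 3)).real {ω | ∃ x ∈
Literature.Probability.LatticeModels.box 3 n, ∃ x' ∈ Literature.Probability.LatticeModels.box 3 n, ∃
y ∈ Literature.Probability.LatticeModels.innerBoundary (Literature.Probability.LatticeModels.zdGraph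
3) (Literature.Probability.LatticeModels.box 3 ⌈(n : ℝ) ^ ((7 : ℝ) / 6)⌉₊), ∃ y' ∈
Literature.Probability.LatticeModels.innerBoundary (Literature.Probability.LatticeModels.zdGraph 3)
(Literature.Probability.LatticeModels.box 3 ⌈(n : ℝ) ^ ((7 : ℝ) / 6)⌉₊), ω ∈
Literature.Probability.Percolation.openConnIn ↑(Literature.Probability.LatticeModels.box 3 ⌈(n : ℝ)
^ ((7 : ℝ) / 6)⌉₊) x y ∧ ω ∈ Literature.Probability.Percolation.openConnIn
↑(Literature.Probability.LatticeModels.box 3 ⌈(n : ℝ) ^ ((7 : ℝ) / 6)⌉₊) x' y' ∧ ω ∉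
Literature.Probability.Percolation.openConnIn ↑(Literature.Probability.LatticeModels.box 3 ⌈(n : ℝ)
^ ((7 : ℝ) / 6)⌉₊) x x'}) Filter.atTop (nhds 0))`

## Assembly
Pure logic given the supports: Assembly is RaceLemma at (a, b) = (1/2, 1/6) after rewriting (3 : ℝ)
− 1/2 = 5/2 and 1 + 1/6 = 7/6
(`norm_num`; the term `example (hR : RaceLemma) : Assembly` elaborates in the planner sketch, rc 0).
Mathematically: θ(p_c) > 0 and U(1/6)
give in-box connection probabilities ≥ θ²/2 between the centre and every point of Λ_r inside
Λ_{⌈r^{7/6}⌉} (JumpUniquenessBoxLRO: Harris–FKG,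
translation invariance, first-exit decomposition), whence a free susceptibility ≥ (θ²/2) r³ = (θ²/2)
R^{18/7}, contradicting S(1/2)'s C R^{5/2}
since 18/7 > 5/2. The summit constant is the audited `PercolationContinuityZ3` (=
Literature.Probability.Percolation.PercolationContinuityZ3,
imported by Summits.CriticalPhenomena.Statement).

Rationale: WHY THIS LINE. In a hypothetical jump world θ(p_c) = θ* > 0 the infinite cluster, watched inside a
free box, is caught between two forces: SHATTERING
(its in-box pieces are small: the free susceptibility is believed o(R³), Hutchcroft2022 =
arXiv:2202.07634 p.5, numerically R^{2−η} with
η = −0.046, HeydenreichVanDerHofstad2017 (1.2.13)) and UNIQUENESS (two distinct clusters cannot both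
cross a polynomially thick annulus:
Cerf2015 = arXiv:1306.3105 Thm 1.2 at aspect r^{43}, by the quantitative Aizenman–Kesten–Newman /
Gandolfi–Grimmett–Russo counting,
AizenmanKestenNewmanCMP1987; VandenbergVanengelenburg2022 = arXiv:2009.13337 and
DuminilcopinIoffeVelenik2016 = arXiv:1409.5199 are the
other quantitative-uniqueness engines). The route quantifies both forces as exponents and shows they
cannot coexist with a jump once
b < a/(3−a): uniqueness at aspect 1+b turns θ* > 0 into in-box long-range order at scale r^{1+b}
(Harris–FKG + first exit of the two
infinite paths; NO uniqueness of the infinite cluster and no sprinkling), and a free power saving a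
> 3b/(1+b) forbids that order by
counting (Σ_{y∈Λ_R} P(0↔y in Λ_R) ≥ (θ*²−o(1))(2r+1)³ ≍ R^{3/(1+b)} versus ≤ C R^{3−a}). Imported:
critical-exponent bookkeeping
(hyperscaling-style exponent inequalities, as in Newman-type 'a jump forces exponent bounds'
arguments) joined to the AKN/Cerf
quantitative-uniqueness technology; Hutchcroft's long-range programme supplies the SHAPE of S (his
restricted estimate (eq. 'weaker'),
|Λ_r|⁻¹ Σ_x P(0↔x inside Λ_r) ≤ A r^{−d+α}, arXiv:2202.07634 p.5, proved for long-range percolation)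
together with his remark that no
technique passes from in-box to full-space estimates — U is offered as exactly that passage in the
counterfactual world. Versus the open
routes: PercFiniteBoxLRO feeds θ > 0 into COUNTERFACTUAL statements (X_D, PolyScaleLRO) and needs
the same-p renormalisation R
(SprinklingRenormalisation barrier head-on); PercTwoPointDecay needs the BULK ball sum X_A, which
alone kills the jump through τ ≥ θ²;
here both cruxes are unconditional, each jump-compatible alone (a jump world may be shattered OR
monolithic, not both), free-boundary,
and the glue is ten lines of counting. Versus the two neighbouring routes opened in parallel today:
PercNonProliferation races free-box
sparsity (qualitative, or a pair-averaged power saving ∃ a > 0) against a bounded or subpolynomial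
NUMBER of spanning clusters at aspect 2
(an RSW-flavoured second crux, glue = Cauchy–Schwarz/BK); PercHyperscalingGluing pairs qualitative
shattering with a hyperscaling gluing
inequality, and its support CerfShortcut is the linear-scale, COUNTERFACTUAL (X_D) version of the
present race. This route's second crux is
instead Cerf-type UNIQUENESS at polynomial aspect, unconditional at p_c, and the budget b < a/(3−a)
prices aspect against saving.
Negatives index (1 entry, SAW sub-problem): untouched.

RANKED CRUXES. #0 Thesis (target) — X = S(1/2) ∧ U(1/6) as in § Thesis (both conjuncts written out;
the route decls FreeSusceptibilityPowerSaving and NearLinearTwoClusterDecay are these two Props).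
(why it might fail: Both halves are open problems: S needs an UPPER bound on critical in-box
connectivity in d=3 (no tool below d_c=6), U needs Cerf's aspect 43 cut to 7/6 with a d<6 input; and
the budget is tight: even with the true a=0.95, U is needed below aspect 1.47.) [Cerf2015,
Hutchcroft2022, VandenbergVanengelenburg2022, arXiv:1306.3105, arXiv:2202.07634]
#2 NearLinearTwoClusterDecay (crux) — U(1/6), card item 'Crux U' at b = 1/6: at p = p_c(ℤ³) (bond),
with m = ⌈n^{7/6}⌉, the probability that the configuration restricted to Λ(m) = box 3 m contains two
DISTINCT open clusters each meeting both Λ(n) and the inner vertex boundary of Λ(m) tends to 0 as n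
→ ∞; encoded exactly as PercFiniteBoxLRO.CritBoxTwoArmsDecay (stmt-CriticalPhenomena-0859)
specialised to α = 7/6: ∃ x, x′ ∈ box 3 n, ∃ y, y′ ∈ innerBoundary (zdGraph 3) (box 3 m) with x ↔ y
and x′ ↔ y′ inside Λ(m) but ¬(x ↔ x′ inside Λ(m)). Cerf2015 Thm 1.2 (site percolation, d = 3):
aspect n^{43} (threshold (2d²+2d−2)(4d²+5d−5)/(2d²+3d−3) = 42.17); vdBvE2022 Prop 2: at every
BOUNDED aspect M the event has probability ≥ δ(3,M) along a scale sequence, so b > 0 is essential;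
the hypothesis `h : CritBoxTwoArmsDecay` closes it by `h (7/6) (by norm_num)` (checked in the
planner sketch). [difficulty: open-problem] (why it might fail: Print: aspect r^43 only (Cerf2015
Thm 1.2, dimension-uniform AKN counting); FALSE at bounded aspect on a scale sequence (vdBvE2022
Prop 2) and for d>6 at small b (L^{d-6} spanning clusters): aspect 7/6 needs a d<6 input nobody has;
Cerf's exponent engine stalls near aspect 8.) [Cerf2015, VandenbergVanengelenburg2022,
DuminilcopinIoffeVelenik2016, AizenmanKestenNewmanCMP1987, Aizenman1997, arXiv:1306.3105,
arXiv:2009.13337, arXiv:1409.5199]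
#3 FreeSusceptibilityPowerSaving (crux) — S(1/2), card item 'Crux S' at a = 1/2, CENTRE-rooted
(weaker than the card's sup over roots; the race needs only the centre): there is C with Σ_{y ∈ box
3 R} P_{p_c}(0 ↔ y inside box 3 R) ≤ C · R^{5/2} for every R ≥ 1, i.e. the expected volume of the
free-boundary (in-box) cluster of the centre of Λ_R is O(R^{5/2}). Truth: ≍ R^{2−η} = R^{2.05} (η =
−0.046); the Gaussian value R² is predicted FALSE (EtaNegativePredictionZ3), R^{5/2} leaves margin
0.45. It is strictly weaker than PercTwoPointDecay.CritBallAverageDecay restricted to a = 1/2 (bulk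
sum Σ_{box 3 R} τ_{p_c}(0,y) ≤ C R^{5/2} implies it, openConnIn ⊆ openConn) and, unlike the bulk
sum, is compatible with θ(p_c) > 0 (a shattered jump world); but any a > 0 excludes the MONOLITHIC
jump branch (linear-scale in-box LRO at p_c would give Σ ≥ c R³), so it is an honest crux, not
folklore (cards free-box-shattering-is-a-branch, free-box-folklore-knife-edge). Shape =
Hutchcroft2022 eq. (weaker) for nearest-neighbour ℤ³ with d − α := 1/2. [difficulty: open-problem]
(why it might fail: Numerically true (2-eta=2.05<5/2) and jump-compatible, but any power saving
kills the monolithic jump branch (linear in-box LRO at p_c), so no soft proof: lowest-point BK+BGN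
needs x_s+x_b>3/2 (false: 1.45), Russo/tree-graph bounds saturate at gamma=1, no infrared bound in
d=3.) [Hutchcroft2022, HeydenreichVanDerHofstad2017, BarskyGrimmettNewman1991, Hutchcroft2021,
arXiv:2202.07634, arXiv:2008.11197,
Summits/CriticalPhenomena/PercolationContinuityZ3/Ideas/free-box-folklore-knife-edge.md,
Summits/CriticalPhenomena/PercolationContinuityZ3/Ideas/free-box-shattering-is-a-branch.md]
#9 JumpUniquenessBoxLRO (support) — For every α > 1: if at p_c the two-distinct-crossing-clusters
event of (Λ(n), Λ(⌈n^α⌉)) (same encoding as the crux, general α) has probability → 0, then for every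
ε > 0, for all large n and all x, x′ ∈ box 3 n, P_{p_c}(x ↔ x′ inside box 3 ⌈n^α⌉) ≥ θ(p_c)² − ε,
θ(p_c) = theta (zdGraph 3) 0 (criticalProbI 3). Proof (provable now, ~300 Lean lines): percolatesAt
x ∩ percolatesAt x′ is an intersection of increasing measurable events, so its probability is ≥ θ_x
θ_{x′} = θ(p_c)² (Literature.Probability.Percolation.harris_fkg_holds + theta_zdGraph_eq_theta_zero,
both PROVED); on it each of x, x′ has an infinite open self-avoiding path, whose initial segment up
to the vertex before its first exit from Λ(m), m = ⌈n^α⌉ ≥ n, is an open path inside Λ(m) ending in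
innerBoundary (zdGraph 3) (box 3 m); if moreover ¬(x ↔ x′ inside Λ(m)) the configuration lies in the
two-cluster event (witnesses x, x′, y, y′); hence P(x ↔ x′ in Λ(m)) ≥ θ² − P(two-cluster event at n)
≥ θ² − ε eventually (Tendsto → eventually < ε). This is 'r5(α) ⟹ r4(α) at p = p_c' for route
PercFiniteBoxLRO and uses NO uniqueness of the infinite cluster. Trivially true when θ(p_c)² ≤ ε.
[difficulty: provable-now] [Cerf2015, GrimmettPercolation1999, arXiv:1306.3105]
#9 RaceLemma (support) — The card's race lemma for ALL exponents (provable now, ~200 lines on top of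
JumpUniquenessBoxLRO): for real a, b with 0 < b and (1+b)(3−a) < 3, S(a) [∃ C, ∀ R ≥ 1, Σ_{y∈box 3
R} P_{p_c}(0 ↔ y inside box 3 R) ≤ C R^{3−a}] and U(b) [two-cluster decay at aspect ⌈n^{1+b}⌉] imply
PercolationContinuityZ3. Proof: suppose θ := theta (zdGraph 3) 0 (criticalProbI 3) ≠ 0, so θ > 0
(measureReal_nonneg). JumpUniquenessBoxLRO's argument at α = 1+b, ε = θ²/2, x = 0 gives N with P(0 ↔
x′ inside Λ_R) ≥ θ²/2 for all r ≥ N, x′ ∈ box 3 r, R = ⌈r^{1+b}⌉ ≥ r (so box 3 r ⊆ box 3 R and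
openConnIn is monotone in the set). Summing over x′ ∈ box 3 r (card_box: (2r+1)³ terms, all other
terms ≥ 0): Σ_{y∈Λ_R} P(0↔y in Λ_R) ≥ (θ²/2)(2r+1)³ ≥ (θ²/2) r³. By S(a) the left side is ≤ C
R^{3−a}; if 3−a ≤ 0 this is ≤ C (R ≥ 1), absurd for large r; else R ≤ 2 r^{1+b} gives ≤ C 2^{3−a}
r^{(1+b)(3−a)} with (1+b)(3−a) < 3, absurd for large r (Real.rpow comparison). Hence θ = 0, i.e.
PercolationContinuityZ3 (percolationContinuityZ3_iff). The Assembly is the instance (a,b) = (1/2,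
1/6); a second admissible instance is (9/10, 2/5): (7/5)(21/10) = 2.94 < 3. [difficulty:
provable-now]
[Summits/CriticalPhenomena/PercolationContinuityZ3/Ideas/shattering-vs-uniqueness-race.md, Cerf2015,
Hutchcroft2022]

TWO-LAYER PLAN. Foreseen glued splits (none filed now). U ⇐ U₁ → U₂ → U with U₁ =
TwoClusterDecayAtSomePolyAspect (∃ α₀: decay at aspect n^{α₀} for BOND
percolation — Cerf's site argument transcribed; milestone shared in spirit with PercFiniteBoxLRO's
Cerf2015BoxLRO16) and U₂ = AspectReduction
(decay at aspect α ⟹ decay at aspect 7/6: the d = 3-specific gluing/membrane input — the real child;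
candidates: dense-piece uniqueness
(card dense-piece-uniqueness-hub), BK⁺/pinned-pair surgery (card kissing-surgery-bulk), the
announced-jump interface lemma). S ⇐ S₁ → S₂ → S
with S₁ = LargestFreeClusterBound (the typical size M_R of the largest cluster of the free box graph
is ≤ C R^{5/2}) and S₂ = universal
tightness of |K_max| (Hutchcroft2021-companion arXiv:2008.11197 Thm 2.2: E|K_max(Λ)| ≤ C′ M_R on any
finite graph; then E|C_Λ(0)| ≤ E|K_max|),
a Literature cite fact. If only a weaker pair (a, b) is proved, RaceLemma re-instantiates without a
new route (restate the two cruxes 1:1).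

KILL CRITERIA. U refuted at b = 1/6 (e.g. an extension of vdBvE2022 Prop 2 from bounded to
polynomial aspect: P(A₂(n, n^{7/6})) ≥ δ along a sequence)
⇒ one restate to (a, b) = (9/10, 2/5) (RaceLemma covers it); U refuted for every b < 0.466 ⇒ `close
--reason refuted:NearLinearTwoClusterDecay`
(no true S can pay: the card's budget is exhausted). S refuted as stated (free susceptibility ≥
R^{5/2+κ} infinitely often — against all
η-numerics; it would mean a near-volume-order critical in-box cluster) ⇒ close
refuted:FreeSusceptibilityPowerSaving and hand the witness to
the monolithic-branch cards. Mooted: PercTwoPointDecay.CritBallAverageDecay proved (continuity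
follows there; S becomes a corollary);
PercFiniteBoxLRO.CritBoxTwoArmsDecay proved ⇒ U closes for free (instance α = 7/6) and the route
reduces to S alone. Pivot: a proof that
some S(a) already implies θ(p_c) = 0 without U (a free ⟹ bulk passage) supersedes this route by a
PercTwoPointDecay-type line.

NOT DECOMPOSED YET. Cerf's exponent-engine milestones (aspect 43 → 16 → …; they are
PercFiniteBoxLRO's r4/r5 business and cannot reach 7/6 alone: α → 1 needs
a two-arms exponent near 8 > mean-field 4); the d = 3 aspect-reduction input for U; the
largest-free-cluster / universal-tightness split
of S; the bond transcription of Cerf's site-percolation theorems; measurability and first-exit path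
lemmas for openConnIn (prover helpers,
attached with --supports JumpUniquenessBoxLRO); the ergodic/density upgrade of the card's original
Markov-counting proof (not needed in the
LRO form adopted here).

CHEAPEST FALSIFIER. (a) Lookup, done this session: does vdBvE2022 (arXiv:2009.13337) Prop 2 / Lemma
4 already give P_{p_c}(A₂(n, M n)) ≥ δ with δ independent
of M (which at M = n^{1/6} would kill U)? No — δ = δ(d, M) comes from a pigeonhole over ≍ log M
scales and degrades with M (p.2 Prop 2,
p.3), so nothing in print contradicts U; a refuter should still try to run their construction with M
= n^{1/6}. (b) One kit Monte-Carlo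
day at p_c(bond ℤ³) = 0.2488: the two-distinct-crossing-clusters frequency for (r, ⌈r^{7/6}⌉), r =
8…64, must decrease in r, and
Σ_{y∈Λ_R} P(0↔y inside Λ_R), R ≤ 128, must scale like R^{2.05±0.05} — a reversed trend kills the
corresponding crux numerically.
(c) Logical: if a refuter shows S(1/2) ∧ U(1/6) holds in the Aizenman–Newman 1/r² jump model's
natural analogue, the glue would be wrong —
it is not: there τ_{p_c} ≥ M² > 0 makes the in-box sum ≍ volume, so S fails, as the race predicts
for any jump world satisfying U.

NUMBERS. η(3) = −0.046(8) (BottcherHerrmann2021 via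
Literature.Barriers.CriticalPhenomena.GaussianDominationRoute) ⇒ free-susceptibility exponent
2 − η ≈ 2.046, so S(a) is true iff a < 0.954; filed a = 1/2 (exponent 5/2). Budget b < a/(3−a): a =
1/2 ⇒ b < 1/5 (filed b = 1/6; slack
3 − 35/12 = 1/12); a = 9/10 ⇒ b < 3/7 (second instance b = 2/5); best possible with a true S: b <
0.954/2.046 = 0.466, i.e. Cerf's aspect
exponent must fall from 43 (site; threshold 42.17, Cerf2015 Thm 1.2) below 1.466 before ANY true S
completes the race; conversely Cerf's
proved aspect would need a > 3 − 3/43 = 2.93 (absurd: the sum is ≥ cR by DuminilCopinTassion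
φ_{p_c}(Λ_n) ≥ 1). Two-arms exponent at
p_c(ℤ³): ≥ 12/23 (Cerf2015 Thm 1.1), ≤ d² + 4d − 2 = 19 (VandenbergVanengelenburg2022 Thm 1). In-box
LRO from θ > 0: scale n^{16}
(Cerf2015 Thm 1.3, site; in tree for site:
Literature.Probability.Percolation.Cerf2015_thm_1_3_three_holds). Items at open: 6 (target,
2 cruxes, 2 supports, assembly).

DEFINITION REQUESTS. None. All constants exist and were checked with `lean search`/the sketch:
Literature.Probability.LatticeModels.box, innerBoundary, zdGraph;
Literature.Probability.Percolation.bondPercolation, criticalProbI, openConnIn, theta;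
PercolationContinuityZ3 (Statement.lean abbrev). Cite
facts that would help provers but are not load-bearing: bond-percolation transcription of Cerf2015
Thm 1.2 (site in print; PercFiniteBoxLRO
already asks for Thm 1.3's), and Hutchcroft's universal tightness (arXiv:2008.11197 Thm 2.2) for the
foreseen split of S.

Novelty: Searches (2026-08-15): `lit frontier CriticalPhenomena --since 2020` (30 rows: SLE/CLE, lace
expansion, long-range; none on in-box
susceptibility vs annulus uniqueness); `lit bridges CriticalPhenomena --cross any` (30 rows:
surveys/monographs); `lit search --hybrid "two
distinct clusters crossing annulus critical percolation three dimensions uniqueness exponent"` (12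
held books: Grimmett1999, BollobasRiordan2006,
HeydenreichVanDerHofstad2017, Kesten1982 …; no race); `lit galaxy search "two-arms exponent" --star
all` (4 pdf hits: DuminilcopinIoffeVelenik2016
quantitative Burton–Keane, DGRST strong percolation; panama queue saturated) and "two distinct
clusters crossing annulus critical percolation" /
"number of spanning clusters" (0 / service saturated); `lit search --source zbmath "quantitative
Burton-Keane estimate strong FKG"` (1:
doi:10.1214/15-aop1049, bib added); openalex/arxiv remote tiers rate-limited (HTTP 429) this
session; `lit read` arXiv:1306.3105 pp.3–4
(Thms 1.1–1.3 verbatim, 'missing ingredient … proportional to n'), arXiv:2009.13337 p.2 (Thm 1, Prop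
2 verbatim), arXiv:2202.07634 p.5
(eq. (weaker) and the folklore sentence verbatim), arXiv:1409.5199 pp.2–3 (Thm 1.1); the 9 route
files of the sub and ~12 neighbouring cards
(nonproliferation-is-enough, dense-piece-uniqueness-hub, free-box-shattering-is-a-branch,
free-box-folklore-knife-edge, jump-forces-spanning-
cluster-proliferation, shattering-is-a-branch, critical-cluster-threshold-one,
announced-jump-dense-f  [refs: 10.1214/15-aop1049, 1306.3105, 2009.13337, 2202.07634, 1409.5199, doi:10.1214/15-aop1049, Grimmett1999, BollobasRiordan2006, HeydenreichVanDerHofstad2017, Kesten1982, DuminilcopinIoffeVelenik2016, Cerf2015, Hutchcroft2022]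

Barriers (technique_class: exponent-race in-box-shattering two-cluster-uniqueness): - technique_class: exponent-race in-box-shattering two-cluster-uniqueness
- Literature.Barriers.CriticalPhenomena.SpanningClustersAboveSix: APPLIES to U and is declared on
the crux: for d > 6 (η = 0) critical boxes carry ≍ L^{d−6} spanning clusters, so the analogue of
U(b) fails for small b while S holds there — the d = 3 content of the route sits entirely in U,
whose proof must use an input false above six dimensions; S and the glue are dimension-free and
claim nothing dimension-uniform.
- Literature.Barriers.CriticalPhenomena.SprinklingRenormalisation: evaded — no block argument and no
change of parameter: the jump is killed AT p_c by counting (in-box LRO at scale r^{1+b} against the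
free susceptibility), never by certifying percolation at p_c ± η; this is the precise difference
from PercFiniteBoxLRO's crux R.
- Literature.Barriers.CriticalPhenomena.TransverseCrossingsNeedNotMeet: not engaged by the glue
(connections inside the box come from the U hypothesis plus first exit, never from intersecting two
crossings); it is one reason U itself is hard (AKN/Cerf surgery must force two clusters to meet),
declared in U's why-it-might-fail.
- Literature.Barriers.CriticalPhenomena.GaussianDominationRoute: S asks for less than an infrared
bound — free b.c., box-averaged, exponent 5/2 not the Gaussian 2 (a = 1/2 < 1 + η ≈ 0.95, the
predicted-true side of EtaNegativePredictionZ3) — but the barrier's point, that no SUPPLY of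
two-point upper bounds exists on ℤ³ below d_c, is not evaded;

Novelty grade: new-combination — route-review (refuter 539a64a6): KEEP. All 6 decls elaborate (W3.lean rc0); Thesis ↔ S∧U by Iff.rfl; `example (h : RaceLemma) : Assembly` proved (norm_num glue). RaceLemma checked on paper: θ>0 ⇒ Harris–FKG θ² + first-exit segments end in innerBoundary + ¬conn-in-box ⇒ two-cluster event, so P(0↔x′ i (refuter refuter-rreview-route-AtomisticToContinu-539a64a6-0, 2026-08-15T13:56:52Z; prior: arXiv:1306.3105, arXiv:2009.13337, arXiv:2202.07634, stmt-CriticalPhenomena-0859)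

History (route lifecycle, newest last):
- 2026-08-24T02:23:44Z · DORMANT — reconciler: no traction for 6.4 d (last activity item-evidence-added at 2026-08-17T14:57:26Z); parked, not closed — `ledger route dormant route-CriticalPhenomen (operator:999:1180210)

sub-problem: PercolationContinuityZ3 · status: dormant · opened planner-plancard-CriticalPhenomena-Percolatio-da688197-0 2026-08-15T11:42:36Z · rev 5 · ledger route-CriticalPhenomena-PercShatteringRace
GENERATED by the gate from the ledger (D-0016/17). Provers cite these decls: `theorem foo : Summit.CriticalPhenomena.PercolationContinuityZ3.Theses.PercShatteringRace.<Decl> := …` in Summits/CriticalPhenomena/PercolationContinuityZ3/Theorems/<Name>.lean.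
-/

namespace Summit.CriticalPhenomena.PercolationContinuityZ3.Theses.PercShatteringRace

open scoped BigOperators Topology Manifold Classical MeasureTheory ProbabilityTheory Matrix InnerProductSpace ComplexConjugate ContinuousMap
open Filter Set Function TopologicalSpace MeasureTheory

attribute [summit_statement] _root_.PercolationContinuityZ3

/-- item stmt-CriticalPhenomena-5784 · target · rank 0 · open · by planner
why it might fail: Conjunction of two open problems: S = an upper bound on critical in-box connectivity on Z^3 (no tool below d_c=6; even o(R^3) unlocated), U = Cerf's site aspect 43 cut to 7/6 for bond; the budget (1+b)(3-a)<3 is tight: with the true a~0.95 (eta=-0.046) U is needed below aspect 1.47.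
sources: Cerf2015, arXiv:1306.3105, Hutchcroft2022, arXiv:2202.07634, VandenbergVanengelenburg2022, arXiv:2009.13337
[target] X = S(1/2) ∧ U(1/6) as in § Thesis (both conjuncts written out; the route decls
FreeSusceptibilityPowerSaving and NearLinearTwoClusterDecay are these two Props). -/
@[route_item "route-CriticalPhenomena-PercShatteringRace"]
def Thesis : Prop :=
  (∃ C : ℝ, ∀ R : ℕ, 1 ≤ R → ∑ y ∈ Literature.Probability.LatticeModels.box 3 R, (Literature.Probability.Percolation.bondPercolation (Literature.Probability.LatticeModels.zdGraph 3) (Literature.Probability.Percolation.criticalProbI 3)).real (Literature.Probability.Percolation.openConnIn ↑(Literature.Probability.LatticeModels.box 3 R) 0 y) ≤ C * (R : ℝ) ^ ((5 : ℝ) / 2)) ∧ (Filter.Tendsto (fun n : ℕ => (Literature.Probability.Percolation.bondPercolation (Literature.Probability.LatticeModels.zdGraph 3) (Literature.Probability.Percolation.criticalProbI 3)).real {ω | ∃ x ∈ Literature.Probability.LatticeModels.box 3 n, ∃ x' ∈ Literature.Probability.LatticeModels.box 3 n, ∃ y ∈ Literature.Probability.LatticeModels.innerBoundary (Literature.Probability.LatticeModels.zdGraph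 3) (Literature.Probability.LatticeModels.box 3 ⌈(n : ℝ) ^ ((7 : ℝ) / 6)⌉₊), ∃ y' ∈ Literature.Probability.LatticeModels.innerBoundary (Literature.Probability.LatticeModels.zdGraph 3) (Literature.Probability.LatticeModels.box 3 ⌈(n : ℝ) ^ ((7 : ℝ) / 6)⌉₊), ω ∈ Literature.Probability.Percolation.openConnIn ↑(Literature.Probability.LatticeModels.box 3 ⌈(n : ℝ) ^ ((7 : ℝ) / 6)⌉₊) x y ∧ ω ∈ Literature.Probability.Percolation.openConnIn ↑(Literature.Probability.LatticeModels.box 3 ⌈(n : ℝ) ^ ((7 : ℝ) / 6)⌉₊) x' y' ∧ ω ∉ Literature.Probability.Percolation.openConnIn ↑(Literature.Probability.LatticeModels.box 3 ⌈(n : ℝ) ^ ((7 : ℝ) / 6)⌉₊) x x'}) Filter.atTop (nhds 0))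

/-- item stmt-CriticalPhenomena-5785 · crux · rank 2 · open · by planner
why it might fail: Print: SITE p_c, aspect n^43 only (arXiv:1306.3105 Thm 1.2 p.3; Cerf2015_thm_1_2_holds); FALSE at bounded aspect M on a scale sequence (arXiv:2009.13337 Prop 2 p.2); mean-field count ~n^{d-6-2b} crossing clusters kills U(1/6) in d>=7 (Aizenman1997): aspect 7/6, bond, needs a d<6 input nobody has.
sources: Cerf2015, arXiv:1306.3105, VandenbergVanengelenburg2022, arXiv:2009.13337, DuminilcopinIoffeVelenik2016, AizenmanKestenNewmanCMP1987
[crux] U(1/6), card item 'Crux U' at b = 1/6: at p = p_c(ℤ³) (bond), with m = ⌈n^{7/6}⌉, the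
probability that the configuration restricted to Λ(m) = box 3 m contains two DISTINCT open clusters
each meeting both Λ(n) and the inner vertex boundary of Λ(m) tends to 0 as n → ∞; encoded exactly as
PercFiniteBoxLRO.CritBoxTwoArmsDecay (stmt-CriticalPhenomena-0859) specialised to α = 7/6: ∃ x, x′ ∈
box 3 n, ∃ y, y′ ∈ innerBoundary (zdGraph 3) (box 3 m) with x ↔ y and x′ ↔ y′ inside Λ(m) but ¬(x ↔
x′ inside Λ(m)). Cerf2015 Thm 1.2 (site percolation, d = 3): aspect n^{43} (threshold
(2d²+2d−2)(4d²+5d−5)/(2d²+3d−3) = 42.17); vdBvE2022 Prop 2: at every BOUNDED aspect M the event has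
probability ≥ δ(3,M) along a scale sequence, so b > 0 is essential; the hypothesis `h :
CritBoxTwoArmsDecay` closes it by `h (7/6) (by norm_num)` (checked in the planner sketch).
[difficulty: open-problem] -/
@[route_item "route-CriticalPhenomena-PercShatteringRace"]
def NearLinearTwoClusterDecay : Prop :=
  Filter.Tendsto (fun n : ℕ => (Literature.Probability.Percolation.bondPercolation (Literature.Probability.LatticeModels.zdGraph 3) (Literature.Probability.Percolation.criticalProbI 3)).real {ω | ∃ x ∈ Literature.Probability.LatticeModels.box 3 n, ∃ x' ∈ Literature.Probability.LatticeModels.box 3 n, ∃ y ∈ Literature.Probability.LatticeModels.innerBoundary (Literature.Probability.LatticeModels.zdGraph 3) (Literature.Probability.LatticeModels.box 3 ⌈(n : ℝ) ^ ((7 : ℝ) / 6)⌉₊), ∃ y' ∈ Literature.Probability.LatticeModels.innerBoundary (Literature.Probability.LatticeModels.zdGraph 3) (Literature.Probability.LatticeModels.box 3 ⌈(n : ℝ) ^ ((7 : ℝ) / 6)⌉₊), ω ∈ Literature.Probability.Percolation.openConnIn ↑(Literature.Probability.LatticeModels.box 3 ⌈(n : ℝ) ^ ((7 : ℝ) / 6)⌉₊)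 x y ∧ ω ∈ Literature.Probability.Percolation.openConnIn ↑(Literature.Probability.LatticeModels.box 3 ⌈(n : ℝ) ^ ((7 : ℝ) / 6)⌉₊) x' y' ∧ ω ∉ Literature.Probability.Percolation.openConnIn ↑(Literature.Probability.LatticeModels.box 3 ⌈(n : ℝ) ^ ((7 : ℝ) / 6)⌉₊) x x'}) Filter.atTop (nhds 0)

/-- item stmt-CriticalPhenomena-5786 · crux · rank 3 · open · by planner
why it might fail: No upper bound on critical connectivities known on Z^3 (lace/IRB only d>=11, FitznerVanDerHofstad2017); even qualitative o(R^3) is unlocated folklore (arXiv:2202.07634 p.5); lowest-point BK+BGN needs x_s+x_b>3/2, numerics 1.45 (card free-box-folklore-knife-edge); any a>0 kills the monolithic jump.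
sources: Hutchcroft2022, arXiv:2202.07634, Hutchcroft2021, arXiv:2008.11197, HeydenreichVanDerHofstad2017, FitznerVanDerHofstad2017
[crux] S(1/2), card item 'Crux S' at a = 1/2, CENTRE-rooted (weaker than the card's sup over roots;
the race needs only the centre): there is C with Σ_{y ∈ box 3 R} P_{p_c}(0 ↔ y inside box 3 R) ≤ C ·
R^{5/2} for every R ≥ 1, i.e. the expected volume of the free-boundary (in-box) cluster of the
centre of Λ_R is O(R^{5/2}). Truth: ≍ R^{2−η} = R^{2.05} (η = −0.046); the Gaussian value R² is
predicted FALSE (EtaNegativePredictionZ3), R^{5/2} leaves margin 0.45. It is strictly weaker than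
PercTwoPointDecay.CritBallAverageDecay restricted to a = 1/2 (bulk sum Σ_{box 3 R} τ_{p_c}(0,y) ≤ C
R^{5/2} implies it, openConnIn ⊆ openConn) and, unlike the bulk sum, is compatible with θ(p_c) > 0
(a shattered jump world); but any a > 0 excludes the MONOLITHIC jump branch (linear-scale in-box LRO
at p_c would give Σ ≥ c R³), so it is an honest crux, not folklore (cards
free-box-shattering-is-a-branch, free-box-folklore-knife-edge). Shape = Hutchcroft2022 eq. (weaker)
for nearest-neighbour ℤ³ with d − α := 1/2. [difficulty: open-problem] -/
@[route_item "route-CriticalPhenomena-PercShatteringRace"]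
def FreeSusceptibilityPowerSaving : Prop :=
  ∃ C : ℝ, ∀ R : ℕ, 1 ≤ R → ∑ y ∈ Literature.Probability.LatticeModels.box 3 R, (Literature.Probability.Percolation.bondPercolation (Literature.Probability.LatticeModels.zdGraph 3) (Literature.Probability.Percolation.criticalProbI 3)).real (Literature.Probability.Percolation.openConnIn ↑(Literature.Probability.LatticeModels.box 3 R) 0 y) ≤ C * (R : ℝ) ^ ((5 : ℝ) / 2)

/-- item stmt-CriticalPhenomena-14153 · support · rank 9 · closed · proved by Summit.CriticalPhenomena.PercolationContinuityZ3.Theorems.thesisOfCruxes_proof (prover) · by planner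
[support] glue (repair of route.target-unreachable): the two cruxes S(1/2) =
FreeSusceptibilityPowerSaving and U(1/6) = NearLinearTwoClusterDecay give the target Thesis, which
is literally their conjunction S(1/2) ∧ U(1/6) (Thesis unfolds to the two crux Props verbatim).
Proof: `fun hS hU => ⟨hS, hU⟩` (planner Sketch.lean rc 0, also `closes hT.1 hT.2 hR :
PercolationContinuityZ3` from `hT : Thesis`). Pure bookkeeping so that the target node is concluded
by an item; the deciding theorem `closes (hS) (hU) (hR : RaceLemma)` is unchanged. [difficulty:
provable-now] sources:
Summits/CriticalPhenomena/PercolationContinuityZ3/Ideas/shattering-vs-uniqueness-race.md -/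
@[route_item "route-CriticalPhenomena-PercShatteringRace"]
def ThesisOfCruxes : Prop :=
  FreeSusceptibilityPowerSaving → NearLinearTwoClusterDecay → Thesis

/-- item stmt-CriticalPhenomena-5787 · support · rank 9 · closed · proved by Summit.CriticalPhenomena.PercolationContinuityZ3.Theorems.jumpUniquenessBoxLRO_proof (prover) · by planner
sources: Cerf2015, GrimmettPercolation1999, arXiv:1306.3105
[support] For every α > 1: if at p_c the two-distinct-crossing-clusters event of (Λ(n), Λ(⌈n^α⌉))
(same encoding as the crux, general α) has probability → 0, then for every ε > 0, for all large n
and all x, x′ ∈ box 3 n, P_{p_c}(x ↔ x′ inside box 3 ⌈n^α⌉) ≥ θ(p_c)² − ε, θ(p_c) = theta (zdGraph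
3) 0 (criticalProbI 3). Proof (provable now, ~300 Lean lines): percolatesAt x ∩ percolatesAt x′ is
an intersection of increasing measurable events, so its probability is ≥ θ_x θ_{x′} = θ(p_c)²
(Literature.Probability.Percolation.harris_fkg_holds + theta_zdGraph_eq_theta_zero, both PROVED); on
it each of x, x′ has an infinite open self-avoiding path, whose initial segment up to the vertex
before its first exit from Λ(m), m = ⌈n^α⌉ ≥ n, is an open path inside Λ(m) ending in innerBoundary
(zdGraph 3) (box 3 m); if moreover ¬(x ↔ x′ inside Λ(m)) the configuration lies in the two-cluster
event (witnesses x, x′, y, y′); hence P(x ↔ x′ in Λ(m)) ≥ θ² − P(two-cluster event at n) ≥ θ² − ε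
eventually (Tendsto → eventually < ε). This is 'r5(α) ⟹ r4(α) at p = p_c' for route PercFiniteBoxLRO
and uses NO uniqueness of the infinite cluster. Trivially true when θ(p_c)² ≤ ε. [difficulty:
provable-now] -/
@[route_item "route-CriticalPhenomena-PercShatteringRace"]
def JumpUniquenessBoxLRO : Prop :=
  ∀ α : ℝ, 1 < α → Filter.Tendsto (fun n : ℕ => (Literature.Probability.Percolation.bondPercolation (Literature.Probability.LatticeModels.zdGraph 3) (Literature.Probability.Percolation.criticalProbI 3)).real {ω | ∃ x ∈ Literature.Probability.LatticeModels.box 3 n, ∃ x' ∈ Literature.Probability.LatticeModels.box 3 n, ∃ y ∈ Literature.Probability.LatticeModels.innerBoundary (Literature.Probability.LatticeModels.zdGraph 3) (Literature.Probability.LatticeModels.box 3 ⌈(n : ℝ) ^ α⌉₊), ∃ y' ∈ Literature.Probability.LatticeModels.innerBoundary (Literature.Probability.LatticeModels.zdGraph 3) (Literature.Probability.LatticeModels.box 3 ⌈(n : ℝ) ^ α⌉₊), ω ∈ Literature.Probability.Percolation.openConnIn ↑(Literature.Probability.LatticeModels.box 3 ⌈(n : ℝ) ^ α⌉₊) x y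 ∧ ω ∈ Literature.Probability.Percolation.openConnIn ↑(Literature.Probability.LatticeModels.box 3 ⌈(n : ℝ) ^ α⌉₊) x' y' ∧ ω ∉ Literature.Probability.Percolation.openConnIn ↑(Literature.Probability.LatticeModels.box 3 ⌈(n : ℝ) ^ α⌉₊) x x'}) Filter.atTop (nhds 0) → ∀ ε : ℝ, 0 < ε → ∀ᶠ n : ℕ in Filter.atTop, ∀ x ∈ Literature.Probability.LatticeModels.box 3 n, ∀ x' ∈ Literature.Probability.LatticeModels.box 3 n, Literature.Probability.Percolation.theta (Literature.Probability.LatticeModels.zdGraph 3) 0 (Literature.Probability.Percolation.criticalProbI 3) ^ 2 - ε ≤ (Literature.Probability.Percolation.bondPercolation (Literature.Probability.LatticeModels.zdGraph 3) (Literature.Probability.Percolation.criticalProbI 3)).real (Literature.Probability.Percolation.openConnIn ↑(Literature.Probability.LatticeModels.box 3 ⌈(n : ℝ) ^ α⌉₊) x x')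

/-- item stmt-CriticalPhenomena-5788 · support · rank 9 · closed · proved by Summit.CriticalPhenomena.PercolationContinuityZ3.Theorems.raceLemma_proof @ b1410290bb74 (prover) · by planner
sources: Summits/CriticalPhenomena/PercolationContinuityZ3/Ideas/shattering-vs-uniqueness-race.md, Cerf2015, Hutchcroft2022
[support] The card's race lemma for ALL exponents (provable now, ~200 lines on top of
JumpUniquenessBoxLRO): for real a, b with 0 < b and (1+b)(3−a) < 3, S(a) [∃ C, ∀ R ≥ 1, Σ_{y∈box 3
R} P_{p_c}(0 ↔ y inside box 3 R) ≤ C R^{3−a}] and U(b) [two-cluster decay at aspect ⌈n^{1+b}⌉] imply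
PercolationContinuityZ3. Proof: suppose θ := theta (zdGraph 3) 0 (criticalProbI 3) ≠ 0, so θ > 0
(measureReal_nonneg). JumpUniquenessBoxLRO's argument at α = 1+b, ε = θ²/2, x = 0 gives N with P(0 ↔
x′ inside Λ_R) ≥ θ²/2 for all r ≥ N, x′ ∈ box 3 r, R = ⌈r^{1+b}⌉ ≥ r (so box 3 r ⊆ box 3 R and
openConnIn is monotone in the set). Summing over x′ ∈ box 3 r (card_box: (2r+1)³ terms, all other
terms ≥ 0): Σ_{y∈Λ_R} P(0↔y in Λ_R) ≥ (θ²/2)(2r+1)³ ≥ (θ²/2) r³. By S(a) the left side is ≤ C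
R^{3−a}; if 3−a ≤ 0 this is ≤ C (R ≥ 1), absurd for large r; else R ≤ 2 r^{1+b} gives ≤ C 2^{3−a}
r^{(1+b)(3−a)} with (1+b)(3−a) < 3, absurd for large r (Real.rpow comparison). Hence θ = 0, i.e.
PercolationContinuityZ3 (percolationContinuityZ3_iff). The Assembly is the instance (a,b) = (1/2,
1/6); a second admissible instance is (9/10, 2/5): (7/5)(21/10) = 2.94 < 3. [difficulty:
provable-now] -/
@[route_item "route-CriticalPhenomena-PercShatteringRace"]
def RaceLemma : Prop :=
  ∀ a b : ℝ, 0 < b → (1 + b) * (3 - a) < 3 → (∃ C : ℝ, ∀ R : ℕ, 1 ≤ R → ∑ y ∈ Literature.Probability.LatticeModels.box 3 R, (Literature.Probability.Percolation.bondPercolation (Literature.Probability.LatticeModels.zdGraph 3) (Literature.Probability.Percolation.criticalProbI 3)).real (Literature.Probability.Percolation.openConnIn ↑(Literature.Probability.LatticeModels.box 3 R) 0 y) ≤ C * (R : ℝ) ^ (3 - a)) → Filter.Tendsto (fun n : ℕ => (Literature.Probability.Percolation.bondPercolation (Literature.Probability.LatticeModels.zdGraph 3) (Literature.Probability.Percolation.criticalProbI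 3)).real {ω | ∃ x ∈ Literature.Probability.LatticeModels.box 3 n, ∃ x' ∈ Literature.Probability.LatticeModels.box 3 n, ∃ y ∈ Literature.Probability.LatticeModels.innerBoundary (Literature.Probability.LatticeModels.zdGraph 3) (Literature.Probability.LatticeModels.box 3 ⌈(n : ℝ) ^ (1 + b)⌉₊), ∃ y' ∈ Literature.Probability.LatticeModels.innerBoundary (Literature.Probability.LatticeModels.zdGraph 3) (Literature.Probability.LatticeModels.box 3 ⌈(n : ℝ) ^ (1 + b)⌉₊), ω ∈ Literature.Probability.Percolation.openConnIn ↑(Literature.Probability.LatticeModels.box 3 ⌈(n : ℝ) ^ (1 + b)⌉₊) x y ∧ ω ∈ Literature.Probability.Percolation.openConnIn ↑(Literature.Probability.LatticeModels.box 3 ⌈(n : ℝ) ^ (1 + b)⌉₊) x' y' ∧ ω ∉ Literature.Probability.Percolation.openConnIn ↑(Literature.Probability.LatticeModels.box 3 ⌈(n : ℝ) ^ (1 + b)⌉₊) x x'}) Filter.atTop (nhds 0) → PercolationContinuityZ3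

/-- item stmt-CriticalPhenomena-5789 · assembly · rank 1 · closed · proved by Summit.CriticalPhenomena.PercolationContinuityZ3.Theorems.percShatteringRace_assembly_proof @ 33d5628fd392 (prover) · by planner
sources: Cerf2015, Hutchcroft2022, GrimmettPercolation1999
[assembly] FreeSusceptibilityPowerSaving → NearLinearTwoClusterDecay → PercolationContinuityZ3
(S(1/2) → U(1/6) → θ(p_c) = 0 on ℤ³), the instance (1/2, 1/6) of RaceLemma: (1 + 1/6)(3 − 1/2) =
35/12 < 3. -/
@[route_item "route-CriticalPhenomena-PercShatteringRace"]
def Assembly : Prop :=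
  FreeSusceptibilityPowerSaving → NearLinearTwoClusterDecay → PercolationContinuityZ3

/-! D-0027 §2.1 — DECIDING THEOREM (planner-authored via `route open/edit --closes-file`; by planner-rbadge-CriticalPhenomena-PercShatterin-d66f018a-g4-0 2026-08-15T16:12:42Z):
its hypotheses are this route's items and its conclusion the sub-problem Statement (glue_lint), and it elaborates with this file. -/

/-- DECIDING THEOREM (D-0027 §2.1) of route PercShatteringRace: the two cruxes S(1/2) =
`FreeSusceptibilityPowerSaving` and U(1/6) = `NearLinearTwoClusterDecay`, together with the support
`RaceLemma` (the card's race lemma for all admissible exponents (a, b), provable now on top of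
`JumpUniquenessBoxLRO`), give `θ(p_c) = 0` on ℤ³, i.e. the sub-problem statement
`PercolationContinuityZ3` by name. The glue is the instance (a, b) = (1/2, 1/6) of `RaceLemma`:
0 < 1/6 and (1 + 1/6)(3 − 1/2) = 35/12 < 3 by `norm_num`, after which the exponents are rewritten
(3 : ℝ) − 1/2 = 5/2 and (1 : ℝ) + 1/6 = 7/6 so that the two hypotheses of the instance are literally
the two crux decls. -/
@[closes "route-CriticalPhenomena-PercShatteringRace"] theorem closes (hS : FreeSusceptibilityPowerSaving) (hU : NearLinearTwoClusterDecay)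
    (hR : RaceLemma) : PercolationContinuityZ3 := by
  have h := hR (1 / 2) (1 / 6) (by norm_num) (by norm_num)
  have e1 : (3 : ℝ) - 1 / 2 = 5 / 2 := by norm_num
  have e2 : (1 : ℝ) + 1 / 6 = 7 / 6 := by norm_num
  rw [e1, e2] at h
  exact h hS hU

end Summit.CriticalPhenomena.PercolationContinuityZ3.Theses.PercShatteringRace
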